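import Literature.Analysis.Convexity.CavalieriSlices
import Summits.Ventures.Crystal3D.Theorems.StickyWulffConstantTextureLiminfTexShadowDefs

/-!
# `PolycrystalWulffBound`, line `PolyDensity`: the CHORD FLIP — cumulative section volumes of a centrally
# symmetric convex body along a normal `ν` and along its mirror image `R_e ν` differ by a shift of at most
# `2 s₀ |⟪e, ν⟫|` when the cap `{⟪x, e⟫ ≥ s₀}` of the body reflects into the body (crux `stmt-Ventures-19482`)

Route `StickyWulffConstant` of the venture `Summits/Ventures/Crystal3D`, second prover lane (poly-p2,
gen 9).  This is the engine of the kernel proof of g8's computational hypothesis `TwinSectionShift (1/√6)`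
(`…TwinSectionShift.lean`): instead of comparing the two cumulative section volumes numerically, couple the
body to itself by FLIPPING EVERY CHORD PARALLEL TO `e` ABOUT ITS OWN MIDPOINT (a volume-preserving
rearrangement, Fubini along the lines parallel to `e`); along a chord with end parameters `lo ≤ hi` the
flip changes `⟪x, ν⟫` into `⟪x, R_e ν⟫ + (lo + hi)⟪e, ν⟫`, and `|lo + hi| ≤ 2 s₀` for every chord as
soon as the mirror image of the cap `K ∩ {⟪x, e⟫ ≥ s₀}` across its base plane lies in `K` (and `K = −K`).
* `volume_eq_lintegral_volume_lineSection` — Cavalieri along the LINES parallel to a unit vector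
  (the companion of `Literature.Analysis.Convexity.volume_eq_lintegral_volume_chartSlice`, which slices by
  planes);
* `volume_le_volume_of_sub_mem` — a set of reals whose image under `a ↦ c − a` lies in `B` has volume
  `≤ |B|`;
* `volume_inter_lt_reflect_le_of_cap` — **the chord flip**: for a compact convex `K = −K`, a unit `e`
  and `s₀` with `x − 2(⟪x,e⟫ − s₀) e ∈ K` whenever `x ∈ K`, `⟪x, e⟫ ≥ s₀`:
  `|K ∩ {⟪x, ν − 2⟪e,ν⟫e⟫ < t}| ≤ |K ∩ {⟪x, ν⟫ < t + δ}|` for every `δ ≥ 2 s₀ |⟪e, ν⟫|`.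
WHAT THIS IS NOT: anything specific to the truncated octahedron (that is `…TwinSectionShiftCubic.lean`);
the crux is not claimed. -/

noncomputable section

open scoped BigOperators InnerProductSpace ENNReal
open MeasureTheory Set

namespace Summit.Ventures.Crystal3D.Theorems

open Summit.Ventures.Crystal3D.Cruxes.TextureLiminf.TexShadow (E3)

/-! ### Cavalieri along lines -/

/-- **Cavalieri along the lines parallel to a unit vector.**  For an orthonormal frame `(U, V, a)` of
`ℝ³` and a measurable `S`: `|S| = ∫⁻ y : ℝ × ℝ, |{s : ℝ | s a + y₁ U + y₂ V ∈ S}|` — the volume is the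
integral over the plane `a^⊥` of the lengths of the sections of `S` by the lines parallel to `a`. -/
theorem volume_eq_lintegral_volume_lineSection {a U V : E3} (ha : ‖a‖ = 1)
    (hU : ‖U‖ = 1) (hV : ‖V‖ = 1) (hUV : ⟪U, V⟫_ℝ = 0) (haU : ⟪a, U⟫_ℝ = 0) (haV : ⟪a, V⟫_ℝ = 0)
    {S : Set E3} (hS : MeasurableSet S) :
    volume S = ∫⁻ y : ℝ × ℝ, volume {s : ℝ | s • a + y.1 • U + y.2 • V ∈ S} := by
  classical
  have hon := Literature.Analysis.Convexity.orthonormal_vec_three ha hU hV hUV haU haV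
  have hsp : ⊤ ≤ Submodule.span ℝ (Set.range ![U, V, a]) :=
    (hon.linearIndependent.span_eq_top_of_card_eq_finrank (by simp)).ge
  set b : OrthonormalBasis (Fin 3) ℝ E3 := OrthonormalBasis.mk hon hsp with hb
  have hb0 : b 0 = U := by simp [hb]
  have hb1 : b 1 = V := by simp [hb]
  have hb2 : b 2 = a := by simp [hb]
  let e : E3 ≃ᵐ (Fin 3 → ℝ) :=
    b.repr.toHomeomorph.toMeasurableEquiv.trans (MeasurableEquiv.toLp 2 (Fin 3 → ℝ)).symm
  have he_apply : ∀ (x : E3) (i : Fin 3), e x i = ⟪b i, x⟫_ℝ := by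
    intro x i
    simp only [e, MeasurableEquiv.coe_trans, Function.comp_apply,
      Homeomorph.toMeasurableEquiv_coe, LinearIsometryEquiv.coe_toHomeomorph,
      MeasurableEquiv.toLp_symm_apply, OrthonormalBasis.repr_apply_apply]
  have he : MeasurePreserving e volume volume := by
    have hfun : (⇑e : E3 → (Fin 3 → ℝ)) = WithLp.ofLp ∘ ⇑b.repr := by funext x; rfl
    rw [hfun]
    exact (PiLp.volume_preserving_ofLp (Fin 3)).comp b.measurePreserving_repr
  let e₂ : (Fin 3 → ℝ) ≃ᵐ ℝ × (Fin 2 → ℝ) := MeasurableEquiv.piFinSuccAbove (fun _ => ℝ) 2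
  have he₂ : MeasurePreserving e₂ volume volume := volume_preserving_piFinSuccAbove (fun _ => ℝ) 2
  let e₃ : (Fin 2 → ℝ) ≃ᵐ ℝ × ℝ := MeasurableEquiv.finTwoArrow
  have he₃ : MeasurePreserving e₃ volume volume := volume_preserving_finTwoArrow ℝ
  set T : Set (ℝ × (Fin 2 → ℝ)) :=
    {q : ℝ × (Fin 2 → ℝ) | q.1 • a + q.2 0 • U + q.2 1 • V ∈ S} with hT
  have hTm : MeasurableSet T := by
    have hc : Continuous fun q : ℝ × (Fin 2 → ℝ) => q.1 • a + q.2 0 • U + q.2 1 • V := by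
      fun_prop
    exact hS.preimage hc.measurable
  have h20 : Fin.succAbove (2 : Fin 3) 0 = 0 := by decide
  have h21 : Fin.succAbove (2 : Fin 3) 1 = 1 := by decide
  have hset : S = e ⁻¹' (e₂ ⁻¹' T) := by
    ext x
    simp only [Set.mem_preimage, MeasurableEquiv.piFinSuccAbove_apply, Fin.insertNthEquiv_symm_apply,
      Fin.removeNth, h20, h21, he_apply, hb0, hb1, hb2, e₂, hT, Set.mem_setOf_eq]
    have h := Literature.Analysis.Convexity.frame_expansion_three ha hU hV hUV haU haV x
    have hx : ⟪a, x⟫_ℝ • a + ⟪U, x⟫_ℝ • U + ⟪V, x⟫_ℝ • V = x := by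
      calc ⟪a, x⟫_ℝ • a + ⟪U, x⟫_ℝ • U + ⟪V, x⟫_ℝ • V
          = ⟪U, x⟫_ℝ • U + ⟪V, x⟫_ℝ • V + ⟪a, x⟫_ℝ • a := by abel
        _ = x := h
    rw [hx]
  have hvol : volume S = volume (e ⁻¹' (e₂ ⁻¹' T)) := congrArg volume hset
  rw [hvol, he.measure_preimage_equiv, he₂.measure_preimage_equiv, Measure.volume_eq_prod,
    Measure.prod_apply_symm hTm, ← he₃.lintegral_comp_emb e₃.measurableEmbedding]
  congr 1

/-! ### The one-dimensional flip -/

/-- A set of reals whose image under the flip `a ↦ c − a` lies in a measurable set `B` has volume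
`≤ |B|` (Lebesgue measure is invariant under `a ↦ c − a`). -/
theorem volume_le_volume_of_sub_mem {A B : Set ℝ} (c : ℝ) (hB : MeasurableSet B)
    (h : ∀ a ∈ A, c - a ∈ B) : volume A ≤ volume B := by
  have hmp : MeasurePreserving (fun a : ℝ => c - a) volume volume := by
    have h := (measurePreserving_add_left (volume : Measure ℝ) c).comp
      (Measure.measurePreserving_neg (volume : Measure ℝ))
    convert h using 1
    funext a
    simp [sub_eq_add_neg]
  calc volume A ≤ volume ((fun a : ℝ => c - a) ⁻¹' B) := measure_mono fun a ha => h a ha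
    _ = volume B := hmp.measure_preimage hB.nullMeasurableSet

/-- **The section of a compact convex set by a line is a compact interval** (when nonempty): for a unit
`a` and a point `y₁ U + y₂ V`, `{s | s a + y₁ U + y₂ V ∈ K} = [lo, hi]`. -/
theorem lineSection_eq_Icc {K : Set E3} (hKc : Convex ℝ K) (hK : IsCompact K) {a : E3} (ha : ‖a‖ = 1)
    (U V : E3) (y : ℝ × ℝ) (hne : {s : ℝ | s • a + y.1 • U + y.2 • V ∈ K}.Nonempty) :
    ∃ lo hi : ℝ, {s : ℝ | s • a + y.1 • U + y.2 • V ∈ K} = Icc lo hi ∧ lo ≤ hi := by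
  set C : Set ℝ := {s : ℝ | s • a + y.1 • U + y.2 • V ∈ K} with hC
  have hiso : Isometry fun s : ℝ => s • a + y.1 • U + y.2 • V := by
    refine Isometry.of_dist_eq fun s s' => ?_
    rw [dist_eq_norm, dist_eq_norm, add_sub_add_right_eq_sub, add_sub_add_right_eq_sub, ← sub_smul,
      norm_smul, ha, mul_one, Real.norm_eq_abs]
  have hCcpt : IsCompact C := hiso.isClosedEmbedding.isCompact_preimage hK
  have hCconv : Convex ℝ C := by
    intro s₁ hs₁ s₂ hs₂ p q hp hq hpq
    have hs₁' : s₁ • a + y.1 • U + y.2 • V ∈ K := hs₁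
    have hs₂' : s₂ • a + y.1 • U + y.2 • V ∈ K := hs₂
    show (p • s₁ + q • s₂) • a + y.1 • U + y.2 • V ∈ K
    have heq : (p • s₁ + q • s₂) • a + y.1 • U + y.2 • V =
        p • (s₁ • a + y.1 • U + y.2 • V) + q • (s₂ • a + y.1 • U + y.2 • V) := by
      calc (p • s₁ + q • s₂) • a + y.1 • U + y.2 • V
          = (p • s₁ + q • s₂) • a + (p + q) • (y.1 • U + y.2 • V) := by
            rw [hpq, one_smul, add_assoc]
        _ = p • (s₁ • a + y.1 • U + y.2 • V) + q • (s₂ • a + y.1 • U + y.2 • V) := by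
            simp only [smul_eq_mul]
            module
    rw [heq]
    exact hKc hs₁' hs₂' hp hq hpq
  have hlo : sInf C ∈ C := hCcpt.sInf_mem hne
  have hhi : sSup C ∈ C := hCcpt.sSup_mem hne
  refine ⟨sInf C, sSup C, Subset.antisymm
    (fun s hs => ⟨csInf_le hCcpt.bddBelow hs, le_csSup hCcpt.bddAbove hs⟩)
    ((convex_iff_ordConnected.1 hCconv).out hlo hhi), csInf_le hCcpt.bddBelow hhi⟩

/-! ### The chord flip -/

/-- **The chord flip.**  Let `K ⊆ ℝ³` be compact, convex and centrally symmetric, `e` a unit vector and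
`s₀` a level such that the mirror image of the cap `K ∩ {⟪x, e⟫ ≥ s₀}` across its base plane lies in
`K` (`x − 2(⟪x,e⟫ − s₀) e ∈ K`).  Then for every `ν`, `t` and `δ ≥ 2 s₀ |⟪e, ν⟫|`:
`|K ∩ {⟪x, R_e ν⟫ < t}| ≤ |K ∩ {⟪x, ν⟫ < t + δ}|`, `R_e ν = ν − 2⟪e, ν⟫ e`.
Proof: Cavalieri along the lines parallel to `e`; on each chord `[lo, hi]` (parameter `s = ⟪x, e⟫`)
one has `|lo + hi| ≤ 2 s₀`, and the flip `s ↦ lo + hi − s` carries `{⟪x, R_e ν⟫ < t}` into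
`{⟪x, ν⟫ < t + δ}`. -/
theorem volume_inter_lt_reflect_le_of_cap {K : Set E3} (hKc : Convex ℝ K) (hK : IsCompact K)
    (hKs : ∀ x ∈ K, -x ∈ K) {e : E3} (he : ‖e‖ = 1) {s₀ : ℝ}
    (hcap : ∀ x ∈ K, s₀ ≤ ⟪x, e⟫_ℝ → x - (2 * (⟪x, e⟫_ℝ - s₀)) • e ∈ K)
    (ν : E3) (t : ℝ) {δ : ℝ} (hδ : 2 * s₀ * |⟪e, ν⟫_ℝ| ≤ δ) :
    volume (K ∩ {x : E3 | ⟪x, ν - (2 * ⟪e, ν⟫_ℝ) • e⟫_ℝ < t}) ≤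
      volume (K ∩ {x : E3 | ⟪x, ν⟫_ℝ < t + δ}) := by
  obtain ⟨U, V, hU, hV, hUV, heU, heV⟩ := Literature.Analysis.Convexity.exists_orthonormal_pair_perp e
  have hKm : MeasurableSet K := hK.isClosed.measurableSet
  have hcont : ∀ μ : E3, Continuous fun x : E3 => ⟪x, μ⟫_ℝ := fun μ =>
    continuous_id.inner continuous_const
  have hLm : MeasurableSet (K ∩ {x : E3 | ⟪x, ν - (2 * ⟪e, ν⟫_ℝ) • e⟫_ℝ < t}) :=
    hKm.inter (isOpen_lt (hcont _) continuous_const).measurableSet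
  have hRm : MeasurableSet (K ∩ {x : E3 | ⟪x, ν⟫_ℝ < t + δ}) :=
    hKm.inter (isOpen_lt (hcont _) continuous_const).measurableSet
  rw [volume_eq_lintegral_volume_lineSection he hU hV hUV heU heV hLm,
    volume_eq_lintegral_volume_lineSection he hU hV hUV heU heV hRm]
  refine lintegral_mono fun y => ?_
  -- coordinates along the line over `y`
  have hee : ⟪e, e⟫_ℝ = 1 := by rw [real_inner_self_eq_norm_sq, he, one_pow]
  have hUe : ⟪U, e⟫_ℝ = 0 := by rw [real_inner_comm]; exact heU
  have hVe : ⟪V, e⟫_ℝ = 0 := by rw [real_inner_comm]; exact heV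
  have hxe : ∀ s : ℝ, ⟪s • e + y.1 • U + y.2 • V, e⟫_ℝ = s := by
    intro s
    rw [inner_add_left, inner_add_left, real_inner_smul_left, real_inner_smul_left,
      real_inner_smul_left, hee, hUe, hVe]
    ring
  have hxν : ∀ s : ℝ, ⟪s • e + y.1 • U + y.2 • V, ν⟫_ℝ =
      s * ⟪e, ν⟫_ℝ + (y.1 * ⟪U, ν⟫_ℝ + y.2 * ⟪V, ν⟫_ℝ) := by
    intro s
    rw [inner_add_left, inner_add_left, real_inner_smul_left, real_inner_smul_left,
      real_inner_smul_left]
    ring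
  have hxRν : ∀ s : ℝ, ⟪s • e + y.1 • U + y.2 • V, ν - (2 * ⟪e, ν⟫_ℝ) • e⟫_ℝ =
      (y.1 * ⟪U, ν⟫_ℝ + y.2 * ⟪V, ν⟫_ℝ) - s * ⟪e, ν⟫_ℝ := by
    intro s
    rw [inner_sub_right, real_inner_smul_right, hxν, hxe]
    ring
  set κ : ℝ := ⟪e, ν⟫_ℝ with hκ
  set β : ℝ := y.1 * ⟪U, ν⟫_ℝ + y.2 * ⟪V, ν⟫_ℝ with hβ
  have hL : {s : ℝ | s • e + y.1 • U + y.2 • V ∈ K ∩ {x : E3 | ⟪x, ν - (2 * κ) • e⟫_ℝ < t}} =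
      {s : ℝ | s • e + y.1 • U + y.2 • V ∈ K ∧ β - s * κ < t} := by
    ext s
    simp only [mem_setOf_eq, mem_inter_iff, hxRν]
  have hR : {s : ℝ | s • e + y.1 • U + y.2 • V ∈ K ∩ {x : E3 | ⟪x, ν⟫_ℝ < t + δ}} =
      {s : ℝ | s • e + y.1 • U + y.2 • V ∈ K ∧ s * κ + β < t + δ} := by
    ext s
    simp only [mem_setOf_eq, mem_inter_iff, hxν]
  rw [hL, hR]
  by_cases hne : {s : ℝ | s • e + y.1 • U + y.2 • V ∈ K}.Nonempty
  · obtain ⟨lo, hi, hC, hlohi⟩ := lineSection_eq_Icc hKc hK he U V y hne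
    have hmemC : ∀ s : ℝ, s • e + y.1 • U + y.2 • V ∈ K ↔ s ∈ Icc lo hi := fun s => by
      rw [← hC]; rfl
    -- the chord midpoint lies in the slab `|⟪x, e⟫| ≤ s₀`
    have hup : lo + hi ≤ 2 * s₀ := by
      by_cases hhi : s₀ ≤ hi
      · have hhiK : hi • e + y.1 • U + y.2 • V ∈ K := (hmemC hi).2 ⟨hlohi, le_rfl⟩
        have h := hcap _ hhiK (by rw [hxe]; exact hhi)
        rw [hxe] at h
        have heq : hi • e + y.1 • U + y.2 • V - (2 * (hi - s₀)) • e =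
            (2 * s₀ - hi) • e + y.1 • U + y.2 • V := by module
        rw [heq, hmemC] at h
        linarith [h.1]
      · have hhi' : hi < s₀ := lt_of_not_ge hhi
        linarith
    have hdown : -(2 * s₀) ≤ lo + hi := by
      by_cases hlo : lo ≤ -s₀
      · have hloK : lo • e + y.1 • U + y.2 • V ∈ K := (hmemC lo).2 ⟨le_rfl, hlohi⟩
        have hneg : -(lo • e + y.1 • U + y.2 • V) ∈ K := hKs _ hloK
        have hinner : ⟪-(lo • e + y.1 • U + y.2 • V), e⟫_ℝ = -lo := by rw [inner_neg_left, hxe]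
        have h := hcap _ hneg (by rw [hinner]; linarith)
        rw [hinner] at h
        have h' := hKs _ h
        have heq : -(-(lo • e + y.1 • U + y.2 • V) - (2 * (-lo - s₀)) • e) =
            (-lo - 2 * s₀) • e + y.1 • U + y.2 • V := by module
        rw [heq, hmemC] at h'
        linarith [h'.2]
      · have hlo' : -s₀ < lo := lt_of_not_ge hlo
        linarith
    have habs : |lo + hi| ≤ 2 * s₀ := abs_le.2 ⟨hdown, hup⟩
    have hRm1 : MeasurableSet {s : ℝ | s • e + y.1 • U + y.2 • V ∈ K ∧ s * κ + β < t + δ} := by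
      have h1 : MeasurableSet {s : ℝ | s • e + y.1 • U + y.2 • V ∈ K} := by
        rw [hC]; exact measurableSet_Icc
      have h2 : MeasurableSet {s : ℝ | s * κ + β < t + δ} :=
        (isOpen_lt (by fun_prop) continuous_const).measurableSet
      exact h1.inter h2
    refine volume_le_volume_of_sub_mem (lo + hi) hRm1 fun s hs => ?_
    obtain ⟨hsK, hst⟩ := hs
    have hsC : s ∈ Icc lo hi := (hmemC s).1 hsK
    refine ⟨(hmemC _).2 ⟨by linarith [hsC.2], by linarith [hsC.1]⟩, ?_⟩
    have h1 : (lo + hi) * κ ≤ |lo + hi| * |κ| := by rw [← abs_mul]; exact le_abs_self _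
    have h2 : |lo + hi| * |κ| ≤ 2 * s₀ * |κ| := mul_le_mul_of_nonneg_right habs (abs_nonneg _)
    have h3 : (lo + hi - s) * κ + β = (lo + hi) * κ + (β - s * κ) := by ring
    rw [h3]
    linarith
  · have h0 : {s : ℝ | s • e + y.1 • U + y.2 • V ∈ K ∧ β - s * κ < t} = ∅ := by
      ext s
      simp only [mem_setOf_eq, mem_empty_iff_false, iff_false, not_and]
      intro hs
      exact absurd ⟨s, hs⟩ hne
    rw [h0, measure_empty]
    exact bot_le

end Summit.Ventures.Crystal3D.Theorems

end
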